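import Summits.QuantumFields.BalabanUV.T4Continuum.Support.B13ReadingsRecordWindow

/-!
# B13ReadingsRecordRate — the W1 record face of `B13ReadingsRecordWindow` (g37-d, p236298) RE-PACKAGED ON THE RATE ROAD: the two-level consistency
# of the background towers is displayed as a PER-BACKGROUND `LocalRate` binder (row NE2's ROOT-B binder, which its bridge
# `NE2FromNE3BavgBridge.localRate_regClass_of_bavg_consistent` discharges from REGULARITY for averaging towers) instead of node NE3's
# `NE3Shape (minActReadings …)`; the potential readings are Lipschitz in an ABSTRACT readings carrier with its own `LocalRate` (ruling R58; answer
# to the substrate-typer's (ο7-2) = Q-S22 «the owner-side `_rate` face please», `HOME/CLAIMS.log` l.22206 ∕ l.22257)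

Cell `pub-balaban`, unit `b2b-balaban-t4-ne5-p1` (row NE5 OWNER, gen 38; owner item «g38-c»).  Summits-side NEW WORK under the LEAN PLACEMENT RULE
([folklore] composition: g37-d's three theorems RE-RUN with the hypothesis `hNE3 : NE3Shape (minActReadings d 𝒞 L N dom (ne2Loc …)) C θ` REPLACED by
(i) an honest rate `0 ≤ θ < 1`, (ii) the per-background two-level-consistency binder `hloc : ∀ V ∈ dom, LocalRate (bgReadings L M (regClass L M (liftR L M
(RgV V)))) C θ` — EXACTLY the binder `B13ReadingsDecay.balaban_twoLevelDecayRate_rate` consumes (g37-d derived it from `hNE3.pointwise` through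
`NE2BalabanFromNE3.localRate_minActReadings_iff`) —, (iii) an ABSTRACT readings carrier `Rp` for the potential species' Lipschitz readings with `hRp : LocalRate Rp C θ`
(`B13ReadingsLocal.potQ∕potR_entryBound_of_localRate` in place of `…_of_ne3Shape`); the datum type of `dom` is freed (`BgD`, any type) since no minimal action is read;
nothing else touched; 0 `def`; nothing printed is asserted; no citation tags).  HONEST FRAMING: rung (B)+1 of the FINITE-VOLUME T⁴ continuum programme — NOT
infinite volume, NOT a mass gap, NOT the Clay problem, NOT a proof of NE5 (NOT PRINTED; GAPS G-t4-U3-1), NOT a proof of NE2: the `LocalRate` binders, the (3.35)-class,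
the threshold and every reading ∕ decay ∕ Lipschitz ∕ domination letter stay DISPLAYED; row NE2's ROOT B inputs (`perturbationLaws_balaban_final_rate`) are consumed BY
NAME inside `balaban_twoLevelDecayRate_rate`.  HONEST DEPENDENCY (cell, verbatim): continuum YM on T⁴ ⇐ BetaPertH ∧ nine spine estimates (0/9 proved); BetaPertH ⇐
(D1) ∧ (D4) ∧ CAP+tail; G-an2-4 gates asym, D1 and NE2/3/4.

WHY (R58).  The real window of record of Road D is the window of AVERAGING TOWERS of free (α′,β′)-regular real fine fields ([Balaban1988RG2Cluster] p. 7: the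
inserted terms are analytic on `U^c_{k+1}(Y, (1+2β)α₀, (1+2β)α₁)` — free complex fine configurations); for such towers two-level consistency is REGULARITY (row
NE2's bridge), not a statement about minimisers, so node NE3 does not enter NE5 and the W1 face of record should display `LocalRate` of the tower — not `NE3Shape`
of `minActReadings`, whose `ActionRate` half is irrelevant here and whose datum type forces unit-lattice driving data.  The substrate typer (ο7-2) asked for this
owner-side `_rate` face so that W-21c `SubstrateO1ReadingsShiftRate` is ONE application at `slotsOfRecordShift` (the W-21b pattern).  g37-d's `…_ne3Shape_on` faces
stay AS LANDED (a true road; W-21b and its five importers unchanged).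

WHAT ([folklore]; 0 def).  `speciesEntryBound_balaban_rate_on`, `weightedEntrywiseRate_balaban_rate_on` (background-generic), and the record face
`weightedEntrywiseRate_record_balaban_rate_on` — conclusions IDENTICAL IN SHAPE to g37-d's (same constant
`√(2B₁·2CpertRec∕(1−max θ L⁻¹)) + √(2B₂·Λ₂·CpertRec) + √(2B₃·Λ₃·CpertRec) + Λ₄C + Λ₅C`, same rate `√(max θ L⁻¹)^k`, the `hwer` binder of `B13StepEndInsOp.ne5_of_record_insOp`
on the nose).  NOTHING LOST: g37-d's `NE3Shape` faces are the rate faces at `hθ0∕hθ1 := hNE3.rate_nonneg∕rate_lt_one`,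
`hloc := fun V hV => (NE2BalabanFromNE3.localRate_minActReadings_iff L M).1 hNE3.pointwise V hV`, `Rp := minActReadings …`, `hRp := hNE3.pointwise` (one `exact`; checked
in the owner's probe `HOME/t4/b2b-balaban-t4-ne5-p1/g38/xprobe/B13ReadingsRecordRateRecover.lean` + its `rfl` statement-identity example, not filed for the 400-line cap).  0 sorry; axioms ⊆ {propext, Classical.choice, Quot.sound}.
-/

noncomputable section

open scoped BigOperators ComplexConjugate Matrix Matrix.Norms.L2Operator Kronecker

namespace Summit.QuantumFields.BalabanUV.T4Continuum.B13ReadingsRecordRate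

open Summit.QuantumFields.BalabanUV.T4Continuum
open Summit.QuantumFields.BalabanUV.T4Continuum.B13OpDatum
open Summit.QuantumFields.BalabanUV.T4Continuum.B13OpDatumJunctions (WeightedEntrywiseRate)
open Summit.QuantumFields.BalabanUV.T4Continuum.B13Readings (SpeciesEntryBound weightedEntrywiseRate_of_entryBound)
open Summit.QuantumFields.BalabanUV.T4Continuum.B13ReadingsLevelWindow (ReadsTowerCovAOn ReadsTowerCovBOn cov_entryBound_of_twoLevelDecayRate_on)
open Summit.QuantumFields.BalabanUV.T4Continuum.B13ReadingsDecay (ReadsTowerCovA ReadsTowerCovB CovWeightDominatesDist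
  cov_entryBound_of_twoLevelDecayRate balaban_twoLevelDecayRate_rate)
open Summit.QuantumFields.BalabanUV.T4Continuum.B13ReadingsImage
open Summit.QuantumFields.BalabanUV.T4Continuum.B13ReadingsDelta (balaban_image_twoLevelDecayRate_rate)
open Summit.QuantumFields.BalabanUV.T4Continuum.B13ReadingsLocal (PotQLipschitzReading PotRLipschitzReading
  potQ_entryBound_of_ne3Shape potR_entryBound_of_ne3Shape potQ_entryBound_of_localRate potR_entryBound_of_localRate speciesEntryBound_of_rates)
open Summit.QuantumFields.BalabanUV.T4Continuum.B13ReadingsRecordWindow (speciesEntryBound_balaban_ne3Shape_on)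
open Summit.QuantumFields.BalabanUV.T4Continuum.B13ReadingsAssembly (CpertRec)
open Summit.QuantumFields.BalabanUV.T4Continuum.DecayRateInterpolation (EntryDecay)
open Summit.QuantumFields.BalabanUV.T4Continuum.CoerciveInverseTower (Coercive)
open Summit.QuantumFields.BalabanUV.T4Continuum.B13Represents (Assembly)
open Summit.QuantumFields.BalabanUV.T4Continuum.B13StepOfRecord (Slots assembly)
open Summit.QuantumFields.BalabanUV.T4Continuum.B13Carriers (TwoRuns)
open Summit.QuantumFields.BalabanUV.T4Continuum.B13HistInsertion (InsDatum)
open Literature.MathematicalPhysics.QuantumFieldTheory.Balaban1983to89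
open Literature.MathematicalPhysics.QuantumFieldTheory.Balaban1983to89.B5Prop11Plancherel (Cst Cst_nonneg Tor fine)
open Literature.MathematicalPhysics.QuantumFieldTheory.Balaban1983to89.B5G183RateUnitTower (lev lev_neZero)
open Literature.MathematicalPhysics.QuantumFieldTheory.Balaban1983to89.T4EtaRateMin (Readings LocalRate NE3Shape)
open Summit.QuantumFields.BalabanUV.T4Continuum.BalabanAveragedTowerUnit (idx Qlev)
open Summit.QuantumFields.BalabanUV.T4Continuum.BackgroundResolventTower
open Summit.QuantumFields.BalabanUV.T4Continuum.KingPairingPlantedLaw (calDalev JpcT CJ CJ_nonneg)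
open Summit.QuantumFields.BalabanUV.T4Continuum.GramPerturbationLaw (C2gram)
open Summit.QuantumFields.BalabanUV.T4Continuum.NE2FromNE3 (bgReadings)
open Summit.QuantumFields.BalabanUV.T4Continuum.NE2ColourPerturbedLayer (pertCovC)
open Summit.QuantumFields.BalabanUV.T4Continuum.RegularBackgroundTower (RegularTransporters regClass betaNE3)
open Summit.QuantumFields.BalabanUV.T4Continuum.GaugeTermScalarData (QuT Q1)
open Summit.QuantumFields.BalabanUV.T4Continuum.RegularSiteTransporters (siteT)
open Summit.QuantumFields.BalabanUV.T4Continuum.NestedContourTransport (theta0)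
open Summit.QuantumFields.BalabanUV.T4Continuum.NE2BalabanRoot (balabanPert)
open Summit.QuantumFields.BalabanUV.T4Continuum.NE2BalabanGauge (gaugeSlot liftR)
open Summit.QuantumFields.BalabanUV.T4Continuum.NE2BalabanLayerSharp (kappaBs C2Bs KstarR)
open Summit.QuantumFields.BalabanUV.T4Continuum.NE2BalabanWiring (epsR CdeltaR epsR_nonneg)
open Summit.QuantumFields.BalabanUV.T4Continuum.NE2BalabanFinal (tauR kappa4F C4F)
open Summit.QuantumFields.BalabanUV.T4Continuum.NE2BalabanThreshold (etaStar smallness_of_le)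
open Summit.QuantumFields.BalabanUV.T4Continuum.NE2FromNE3Carrier (ne2Loc)
open Summit.QuantumFields.BalabanUV.T4Continuum.NE2BalabanFromNE3 (localRate_minActReadings_iff)
open Summit.QuantumFields.BalabanUV.T4Continuum.MinimalActionRate (minActReadings)

/-! ## §1 The background-generic twins (the raw species' background type decoupled from node NE3's datum type) -/

section Generic

variable {d : ℕ} (L : ℕ) [NeZero L] (M : Fin d → ℕ) [hM : ∀ μ, NeZero (M μ)] (a : ℝ) (ha : 0 < a)
variable {o : Type*} [Fintype o] [DecidableEq o] {α β C a' η : ℝ} {Bg Bg' : Type*}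
variable {T κ ι Ω 𝒴 m : Type*} [Fintype m] [DecidableEq m] {BgD ιp Xp : Type*}

/-- [folklore] **RATE-ROAD twin of g37-d's `speciesEntryBound_balaban_ne3Shape_on` (R58 ∕ Q-S22)**: `NE3Shape (minActReadings …)` REPLACED by `0 ≤ θ < 1`, the
per-background `LocalRate` of the coefficient towers (`hloc`, row NE2's binder — regularity for averaging towers) and an abstract potential-readings carrier `Rp` with
`LocalRate Rp C θ`; otherwise VERBATIM.  Original docstring: the covariance readings are displayed
ON A WINDOW `Scov` of aligned indices (`ReadsTowerCovAOn`∕`ReadsTowerCovBOn`, g37-c) and OFF the window the two runs' covariance slots AGREE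
(`hoff` — at the substrate's shifted slots both read `0` above run A's top, W-21 `cov_aligned_junk`); everything else verbatim.  Proof = p224830's
script with the cov conjunct split on `k ∈ Scov` (on: `cov_entryBound_of_twoLevelDecayRate_on`; off: `‖0‖ ≤ bound`). -/
theorem speciesEntryBound_balaban_rate_on {dom : Set BgD} (hL : 2 ≤ L) (hd : 1 ≤ d)
    {RgV : BgD → ((k : ℕ) → Fin d → (Tor (fine (lev L k) M) → Matrix o o ℂ))}
    (hreg : ∀ V ∈ dom, RegularTransporters L M (liftR L M (RgV V)) α β) (hα : 0 ≤ α) (hβ : 0 ≤ β) (hC : 0 ≤ C) {θ : ℝ}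
    (hθ0 : 0 ≤ θ) (hθ1 : θ < 1) (hloc : ∀ V ∈ dom, LocalRate (bgReadings L M (regClass L M (liftR L M (RgV V)))) C θ)
    {Rp : Readings ιp Xp} (hRp : LocalRate Rp C θ)
    (ha' : 0 < a') (hαη : α ≤ η) (hβη : β ≤ η) (hη : η ≤ etaStar o d a a')
    {Fk : ℕ → Format (Species T κ ι Ω 𝒴)} {tow : ℕ → (ℕ → ℝ) → Bg' → ↥dom}
    {rawA rawB : (ℕ → ℝ) → Bg' → ℕ → RawSpecies T κ ι Ω 𝒴} {W : Set (ℕ → ℝ)}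
    {σ : T → κ → idx L M 0 × o} {dist₁ : idx L M 0 × o → idx L M 0 × o → ℝ} {B₁ δ₁ : ℝ}
    (hdec : ∀ V ∈ dom, ∀ k, EntryDecay dist₁
      (pertCovC L M a ha (balabanPert L M a (liftR L M (RgV V)) (gaugeSlot L M (RgV V) (QuT L M o (siteT L M (RgV V))) (Q1 L M o) a'))
        1 k) B₁ δ₁)
    {Scov : Set ℕ} (hcovA : ReadsTowerCovAOn Scov
      (fun V : ↥dom => pertCovC L M a ha
        (balabanPert L M a (liftR L M (RgV V)) (gaugeSlot L M (RgV V) (QuT L M o (siteT L M (RgV V))) (Q1 L M o) a')) 1)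
      σ tow rawA W)
    (hcovB : ReadsTowerCovBOn Scov
      (fun V : ↥dom => pertCovC L M a ha
        (balabanPert L M a (liftR L M (RgV V)) (gaugeSlot L M (RgV V) (QuT L M o (siteT L M (RgV V))) (Q1 L M o) a')) 1)
      σ tow rawB W)
    (hdom₁ : CovWeightDominatesDist Fk dist₁ σ (δ₁ / 2))
    (hoff : ∀ k ∉ Scov, ∀ g ∈ W, ∀ (U : Bg') (t : T) (p q : κ), (rawA g U k).cov t p q = (rawB g U k).cov t p q)
    {S₂ : Set (Matrix (idx L M 0 × o) (idx L M 0 × o) ℂ)} {Φ : T → Matrix (idx L M 0 × o) (idx L M 0 × o) ℂ → Matrix m m ℂ}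
    {Λ₂ : ℝ} (hΦ : ∀ t, OpLipschitzOn S₂ (Φ t) Λ₂) (hΛ₂ : 0 ≤ Λ₂)
    (hS₂ : ∀ V ∈ dom, ∀ k, pertCovC L M a ha
      (balabanPert L M a (liftR L M (RgV V)) (gaugeSlot L M (RgV V) (QuT L M o (siteT L M (RgV V))) (Q1 L M o) a')) 1 k ∈ S₂)
    {dist₂ : m → m → ℝ} {B₂ δ₂ : ℝ}
    (hdecΦ : ∀ V ∈ dom, ∀ t k, EntryDecay dist₂ (Φ t (pertCovC L M a ha
      (balabanPert L M a (liftR L M (RgV V)) (gaugeSlot L M (RgV V) (QuT L M o (siteT L M (RgV V))) (Q1 L M o) a')) 1 k)) B₂ δ₂)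
    {σX : T → ι → m}
    (hΔA : ReadsTowerDeltaA (fun (V : ↥dom) t k => Φ t (pertCovC L M a ha
      (balabanPert L M a (liftR L M (RgV V)) (gaugeSlot L M (RgV V) (QuT L M o (siteT L M (RgV V))) (Q1 L M o) a')) 1 k))
      σX tow rawA W)
    (hΔB : ReadsTowerDeltaB (fun (V : ↥dom) t k => Φ t (pertCovC L M a ha
      (balabanPert L M a (liftR L M (RgV V)) (gaugeSlot L M (RgV V) (QuT L M o (siteT L M (RgV V))) (Q1 L M o) a')) 1 k))
      σX tow rawB W)
    (hdom₂ : DeltaWeightDominatesDist Fk dist₂ σX (δ₂ / 2))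
    {S₃ : Set (Matrix (idx L M 0 × o) (idx L M 0 × o) ℂ)} {Ψ : T → Matrix (idx L M 0 × o) (idx L M 0 × o) ℂ → Matrix m m ℂ}
    {Λ₃ : ℝ} (hΨ : ∀ t, OpLipschitzOn S₃ (Ψ t) Λ₃) (hΛ₃ : 0 ≤ Λ₃)
    (hS₃ : ∀ V ∈ dom, ∀ k, pertCovC L M a ha
      (balabanPert L M a (liftR L M (RgV V)) (gaugeSlot L M (RgV V) (QuT L M o (siteT L M (RgV V))) (Q1 L M o) a')) 1 k ∈ S₃)
    {dist₃ : m → m → ℝ} {B₃ δ₃ : ℝ}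
    (hdecΨ : ∀ V ∈ dom, ∀ t k, EntryDecay dist₃ (Ψ t (pertCovC L M a ha
      (balabanPert L M a (liftR L M (RgV V)) (gaugeSlot L M (RgV V) (QuT L M o (siteT L M (RgV V))) (Q1 L M o) a')) 1 k)) B₃ δ₃)
    {σB : T → κ → m}
    (hΓA : ReadsTowerGammaA (fun (V : ↥dom) t k => Ψ t (pertCovC L M a ha
      (balabanPert L M a (liftR L M (RgV V)) (gaugeSlot L M (RgV V) (QuT L M o (siteT L M (RgV V))) (Q1 L M o) a')) 1 k))
      σB σX tow rawA W)
    (hΓB : ReadsTowerGammaB (fun (V : ↥dom) t k => Ψ t (pertCovC L M a ha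
      (balabanPert L M a (liftR L M (RgV V)) (gaugeSlot L M (RgV V) (QuT L M o (siteT L M (RgV V))) (Q1 L M o) a')) 1 k))
      σB σX tow rawB W)
    (hdom₃ : GammaWeightDominatesDist Fk dist₃ σB σX (δ₃ / 2))
    {Λ₄ Λ₅ : ℝ} (hΛ₄ : 0 ≤ Λ₄) (hΛ₅ : 0 ≤ Λ₅)
    (hQ : PotQLipschitzReading Rp Fk rawA rawB W Λ₄)
    (hR : PotRLipschitzReading Rp Fk rawA rawB W Λ₅)
    (k : ℕ) {g : ℕ → ℝ} (hg : g ∈ W) (U : Bg') :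
    SpeciesEntryBound (Fk k) (rawA g U k) (rawB g U k)
      ((Real.sqrt (2 * B₁ * (2 * CpertRec o d L a α β C a' / (1 - max θ ((L : ℝ)⁻¹)))) +
          Real.sqrt (2 * B₂ * (Λ₂ * CpertRec o d L a α β C a')) +
          Real.sqrt (2 * B₃ * (Λ₃ * CpertRec o d L a α β C a')) +
          Λ₄ * C + Λ₅ * C) * Real.sqrt (max θ ((L : ℝ)⁻¹)) ^ k) := by
  have hL1 : (1 : ℝ) < L := by exact_mod_cast (lt_of_lt_of_le one_lt_two hL : 1 < L)
  have hlt : max θ ((L : ℝ)⁻¹) < 1 := max_lt hθ1 (inv_lt_one_of_one_lt₀ hL1)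
  have hρ0 : 0 ≤ max θ ((L : ℝ)⁻¹) := hθ0.trans (le_max_left _ _)
  have hloc' : ∀ V ∈ dom, LocalRate (bgReadings L M (regClass L M (liftR L M (RgV V)))) C (max θ ((L : ℝ)⁻¹)) := fun V hV =>
    (hloc V hV).mono le_rfl hθ0 (le_max_left _ _) hC
  have hθΘ : θ ≤ Real.sqrt (max θ ((L : ℝ)⁻¹)) := by
    have hs : Real.sqrt (max θ ((L : ℝ)⁻¹)) ≤ 1 := by
      rw [show (1 : ℝ) = Real.sqrt 1 from Real.sqrt_one.symm]
      exact Real.sqrt_le_sqrt hlt.le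
    calc θ ≤ max θ ((L : ℝ)⁻¹) := le_max_left _ _
      _ = Real.sqrt (max θ ((L : ℝ)⁻¹)) * Real.sqrt (max θ ((L : ℝ)⁻¹)) := (Real.mul_self_sqrt hρ0).symm
      _ ≤ Real.sqrt (max θ ((L : ℝ)⁻¹)) * 1 := mul_le_mul_of_nonneg_left hs (Real.sqrt_nonneg _)
      _ = Real.sqrt (max θ ((L : ℝ)⁻¹)) := mul_one _
  have hΛC₄ : 0 ≤ Λ₄ * C := mul_nonneg hΛ₄ hC
  have hΛC₅ : 0 ≤ Λ₅ * C := mul_nonneg hΛ₅ hC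
  unfold CpertRec
  refine speciesEntryBound_of_rates
    (fun t a'' a''' => by
      by_cases hk : k ∈ Scov
      · exact cov_entryBound_of_twoLevelDecayRate_on (Real.sqrt_nonneg _) (Real.sqrt_nonneg _)
          (fun V : ↥dom => balaban_twoLevelDecayRate_rate L M a ha hd (hreg V.1 V.2) hα hβ hC (le_max_right _ _) hlt (hloc' V.1 V.2) ha' hαη
            hβη hη (hdec V.1 V.2)) hcovA hcovB hdom₁ hk hg U t a'' a'''
      · rw [hoff k hk g hg U t a'' a''', sub_self, norm_zero]
        exact mul_nonneg (mul_nonneg (Real.sqrt_nonneg _) (pow_nonneg (Real.sqrt_nonneg _) k)) ((Fk k).wt_pos _).le)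
    (fun t i j => deltaKer_entryBound_of_twoLevelDecayRate (Real.sqrt_nonneg _) (Real.sqrt_nonneg _)
      (fun (V : ↥dom) t => balaban_image_twoLevelDecayRate_rate L M a ha hd hreg hα hβ hC (le_max_right _ _) hlt hloc' ha' hαη hβη hη hΦ
        hΛ₂ hS₂ hdecΦ V.1 V.2 t) hΔA hΔB hdom₂ k hg U t i j)
    (fun t a'' i => gammaConstituent_entryBound_of_twoLevelDecayRate (Real.sqrt_nonneg _) (Real.sqrt_nonneg _)
      (fun (V : ↥dom) t => balaban_image_twoLevelDecayRate_rate L M a ha hd hreg hα hβ hC (le_max_right _ _) hlt hloc' ha' hαη hβη hη hΨ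
        hΛ₃ hS₃ hdecΨ V.1 V.2 t) hΓA hΓB hdom₃ k hg U t a'' i)
    (fun x Y b b' => potQ_entryBound_of_localRate hΛ₄ hRp hQ k hg U x Y b b')
    (fun x Y => potR_entryBound_of_localRate hΛ₅ hRp hR k hg U x Y)
    (Real.sqrt_nonneg _) (Real.sqrt_nonneg _) (Real.sqrt_nonneg _) hΛC₄ hΛC₅ ?_ ?_ ?_ ?_ ?_
    (Real.sqrt_nonneg _) (Real.sqrt_nonneg _) (Real.sqrt_nonneg _) hθ0 hθ0 le_rfl le_rfl le_rfl hθΘ hθΘ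
  all_goals
    linarith [Real.sqrt_nonneg (2 * B₁ * (2 *
        Cpert (kappaBs o d a α β (a * (epsR o d α * (2 + epsR o d α) * Cst d a)) (kappa4F d a a' α β)) (2 * d * Cst d a) (CJ d a)
          (C2Bs o d L a α β C
            (a * C2gram (Cst d a) 1 (epsR o d α) (2 * d * Cst d a) (CJ d a) (Cst d a) (CdeltaR o d a α (theta0 d α (betaNE3 o C))))
            (C4F o d L a a' α β C)) 0 1 / (1 - max θ ((L : ℝ)⁻¹)))),
      Real.sqrt_nonneg (2 * B₂ * (Λ₂ *
        Cpert (kappaBs o d a α β (a * (epsR o d α * (2 + epsR o d α) * Cst d a)) (kappa4F d a a' α β)) (2 * d * Cst d a) (CJ d a)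
          (C2Bs o d L a α β C
            (a * C2gram (Cst d a) 1 (epsR o d α) (2 * d * Cst d a) (CJ d a) (Cst d a) (CdeltaR o d a α (theta0 d α (betaNE3 o C))))
            (C4F o d L a a' α β C)) 0 1)),
      Real.sqrt_nonneg (2 * B₃ * (Λ₃ *
        Cpert (kappaBs o d a α β (a * (epsR o d α * (2 + epsR o d α) * Cst d a)) (kappa4F d a a' α β)) (2 * d * Cst d a) (CJ d a)
          (C2Bs o d L a α β C
            (a * C2gram (Cst d a) 1 (epsR o d α) (2 * d * Cst d a) (CJ d a) (Cst d a) (CdeltaR o d a α (theta0 d α (betaNE3 o C))))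
            (C4F o d L a a' α β C)) 0 1))]

/-- [folklore] **RATE-ROAD twin of g37-d's `weightedEntrywiseRate_balaban_ne3Shape_on`**: the same full-`ℕ` `WeightedEntrywiseRate` conclusion from the WINDOWED
covariance readings + off-window agreement, with `LocalRate` binders in place of `NE3Shape`. -/
theorem weightedEntrywiseRate_balaban_rate_on {dom : Set BgD} (hL : 2 ≤ L) (hd : 1 ≤ d)
    {RgV : BgD → ((k : ℕ) → Fin d → (Tor (fine (lev L k) M) → Matrix o o ℂ))}
    (hreg : ∀ V ∈ dom, RegularTransporters L M (liftR L M (RgV V)) α β) (hα : 0 ≤ α) (hβ : 0 ≤ β) (hC : 0 ≤ C) {θ : ℝ}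
    (hθ0 : 0 ≤ θ) (hθ1 : θ < 1) (hloc : ∀ V ∈ dom, LocalRate (bgReadings L M (regClass L M (liftR L M (RgV V)))) C θ)
    {Rp : Readings ιp Xp} (hRp : LocalRate Rp C θ)
    (ha' : 0 < a') (hαη : α ≤ η) (hβη : β ≤ η) (hη : η ≤ etaStar o d a a')
    {Fk : ℕ → Format (Species T κ ι Ω 𝒴)} {tow : ℕ → (ℕ → ℝ) → Bg' → ↥dom}
    {rawA rawB : (ℕ → ℝ) → Bg' → ℕ → RawSpecies T κ ι Ω 𝒴} {W : Set (ℕ → ℝ)}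
    {σ : T → κ → idx L M 0 × o} {dist₁ : idx L M 0 × o → idx L M 0 × o → ℝ} {B₁ δ₁ : ℝ}
    (hdec : ∀ V ∈ dom, ∀ k, EntryDecay dist₁
      (pertCovC L M a ha (balabanPert L M a (liftR L M (RgV V)) (gaugeSlot L M (RgV V) (QuT L M o (siteT L M (RgV V))) (Q1 L M o) a'))
        1 k) B₁ δ₁)
    {Scov : Set ℕ} (hcovA : ReadsTowerCovAOn Scov
      (fun V : ↥dom => pertCovC L M a ha
        (balabanPert L M a (liftR L M (RgV V)) (gaugeSlot L M (RgV V) (QuT L M o (siteT L M (RgV V))) (Q1 L M o) a')) 1)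
      σ tow rawA W)
    (hcovB : ReadsTowerCovBOn Scov
      (fun V : ↥dom => pertCovC L M a ha
        (balabanPert L M a (liftR L M (RgV V)) (gaugeSlot L M (RgV V) (QuT L M o (siteT L M (RgV V))) (Q1 L M o) a')) 1)
      σ tow rawB W)
    (hdom₁ : CovWeightDominatesDist Fk dist₁ σ (δ₁ / 2))
    (hoff : ∀ k ∉ Scov, ∀ g ∈ W, ∀ (U : Bg') (t : T) (p q : κ), (rawA g U k).cov t p q = (rawB g U k).cov t p q)
    {S₂ : Set (Matrix (idx L M 0 × o) (idx L M 0 × o) ℂ)} {Φ : T → Matrix (idx L M 0 × o) (idx L M 0 × o) ℂ → Matrix m m ℂ}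
    {Λ₂ : ℝ} (hΦ : ∀ t, OpLipschitzOn S₂ (Φ t) Λ₂) (hΛ₂ : 0 ≤ Λ₂)
    (hS₂ : ∀ V ∈ dom, ∀ k, pertCovC L M a ha
      (balabanPert L M a (liftR L M (RgV V)) (gaugeSlot L M (RgV V) (QuT L M o (siteT L M (RgV V))) (Q1 L M o) a')) 1 k ∈ S₂)
    {dist₂ : m → m → ℝ} {B₂ δ₂ : ℝ}
    (hdecΦ : ∀ V ∈ dom, ∀ t k, EntryDecay dist₂ (Φ t (pertCovC L M a ha
      (balabanPert L M a (liftR L M (RgV V)) (gaugeSlot L M (RgV V) (QuT L M o (siteT L M (RgV V))) (Q1 L M o) a')) 1 k)) B₂ δ₂)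
    {σX : T → ι → m}
    (hΔA : ReadsTowerDeltaA (fun (V : ↥dom) t k => Φ t (pertCovC L M a ha
      (balabanPert L M a (liftR L M (RgV V)) (gaugeSlot L M (RgV V) (QuT L M o (siteT L M (RgV V))) (Q1 L M o) a')) 1 k))
      σX tow rawA W)
    (hΔB : ReadsTowerDeltaB (fun (V : ↥dom) t k => Φ t (pertCovC L M a ha
      (balabanPert L M a (liftR L M (RgV V)) (gaugeSlot L M (RgV V) (QuT L M o (siteT L M (RgV V))) (Q1 L M o) a')) 1 k))
      σX tow rawB W)
    (hdom₂ : DeltaWeightDominatesDist Fk dist₂ σX (δ₂ / 2))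
    {S₃ : Set (Matrix (idx L M 0 × o) (idx L M 0 × o) ℂ)} {Ψ : T → Matrix (idx L M 0 × o) (idx L M 0 × o) ℂ → Matrix m m ℂ}
    {Λ₃ : ℝ} (hΨ : ∀ t, OpLipschitzOn S₃ (Ψ t) Λ₃) (hΛ₃ : 0 ≤ Λ₃)
    (hS₃ : ∀ V ∈ dom, ∀ k, pertCovC L M a ha
      (balabanPert L M a (liftR L M (RgV V)) (gaugeSlot L M (RgV V) (QuT L M o (siteT L M (RgV V))) (Q1 L M o) a')) 1 k ∈ S₃)
    {dist₃ : m → m → ℝ} {B₃ δ₃ : ℝ}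
    (hdecΨ : ∀ V ∈ dom, ∀ t k, EntryDecay dist₃ (Ψ t (pertCovC L M a ha
      (balabanPert L M a (liftR L M (RgV V)) (gaugeSlot L M (RgV V) (QuT L M o (siteT L M (RgV V))) (Q1 L M o) a')) 1 k)) B₃ δ₃)
    {σB : T → κ → m}
    (hΓA : ReadsTowerGammaA (fun (V : ↥dom) t k => Ψ t (pertCovC L M a ha
      (balabanPert L M a (liftR L M (RgV V)) (gaugeSlot L M (RgV V) (QuT L M o (siteT L M (RgV V))) (Q1 L M o) a')) 1 k))
      σB σX tow rawA W)
    (hΓB : ReadsTowerGammaB (fun (V : ↥dom) t k => Ψ t (pertCovC L M a ha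
      (balabanPert L M a (liftR L M (RgV V)) (gaugeSlot L M (RgV V) (QuT L M o (siteT L M (RgV V))) (Q1 L M o) a')) 1 k))
      σB σX tow rawB W)
    (hdom₃ : GammaWeightDominatesDist Fk dist₃ σB σX (δ₃ / 2))
    {Λ₄ Λ₅ : ℝ} (hΛ₄ : 0 ≤ Λ₄) (hΛ₅ : 0 ≤ Λ₅)
    (hQ : PotQLipschitzReading Rp Fk rawA rawB W Λ₄)
    (hR : PotRLipschitzReading Rp Fk rawA rawB W Λ₅) :
    WeightedEntrywiseRate Fk (fun g U k => (rawA g U k).kernel) (fun g U k => (rawB g U k).kernel) W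
      (Real.sqrt (2 * B₁ * (2 * CpertRec o d L a α β C a' / (1 - max θ ((L : ℝ)⁻¹)))) +
          Real.sqrt (2 * B₂ * (Λ₂ * CpertRec o d L a α β C a')) +
          Real.sqrt (2 * B₃ * (Λ₃ * CpertRec o d L a α β C a')) +
          Λ₄ * C + Λ₅ * C)
      (fun k => Real.sqrt (max θ ((L : ℝ)⁻¹)) ^ k) :=
  weightedEntrywiseRate_of_entryBound fun k _ hg U =>
    speciesEntryBound_balaban_rate_on L M a ha hL hd hreg hα hβ hC hθ0 hθ1 hloc hRp ha' hαη hβη hη hdec hcovA hcovB hdom₁ hoff hΦ hΛ₂ hS₂ hdecΦ hΔA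
      hΔB hdom₂ hΨ hΛ₃ hS₃ hdecΨ hΓA hΓB hdom₃ hΛ₄ hΛ₅ hQ hR k hg U

end Generic

/-! ## §2 The record face: the `hwer` binder of `B13StepEndInsOp.ne5_of_record_insOp` on `TwoRuns.carriers` -/

section Record

variable {G : Type} [GaugeGroup G] {R : TwoRuns G}
variable {d : ℕ} (L : ℕ) [NeZero L] (M : Fin d → ℕ) [hM : ∀ μ, NeZero (M μ)] (a : ℝ) (ha : 0 < a)
variable {o : Type*} [Fintype o] [DecidableEq o] {α β C a' η : ℝ}
variable {T κ ι Ω 𝒴 m : Type*} [Fintype m] [DecidableEq m] {BgD ιp Xp : Type*}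
variable {IOp Hist : Type*} [NormedAddCommGroup Hist] [NormedSpace ℂ Hist]

/-- [folklore] **THE RECORD FACE ON THE RATE ROAD (ruling R58 = answer to the substrate-typer's (ο7-2) ∕ Q-S22): W1 OF RECORD ON THE CARRIERS OF RECORD from the
WINDOWED covariance readings + off-window agreement `hoff`, the towers' two-level consistency displayed as per-background `LocalRate` binders (`hloc`) and the
potential readings' carrier abstract (`Rp`, `hRp`)** — ONE application for the substrate's W-21c `SubstrateO1ReadingsShiftRate` (`Scov := {k | k ≤ D.K}`; `hloc` from row
NE2's bridge `NE2FromNE3BavgBridge.localRate_regClass_of_bavg_consistent` for the averaging towers of regular fields).  g37-d's docstring of the NE3Shape face for reference: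
**THE RECORD FACE — W1 OF RECORD ON THE CARRIERS OF RECORD.**  For ANY pair of runs `R` and ANY slots `S` over `R.carriers` whose raw
suppliers are the KERNELS of raw species (`hSA`, `hSB` — `rfl` at substrate O-8 `slotsOfRecord`), run A's species read at run-A backgrounds and fed at the
TRANSPORTED background (RULE R4: `(assembly S).rawAt g U k = S.rawA g (R.carriers.transport U) k`, `rfl`), and a reading map
`tow : ℕ → (ℕ → ℝ) → R.carriers.BgB → ↥dom` into node NE3's admissible data: `NE3Shape (minActReadings …) C θ` (OPEN, row NE3) ∧ the (3.35)-class ∧ the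
threshold ∧ the O1 instance's decay ∕ op-Lipschitz ∕ tower-reading ∕ domination ∕ potential-Lipschitz LETTERS ⟹ the `hwer` binder of
`B13StepEndInsOp.ne5_of_record_insOp S E₀ cB` at `c₁ = √(2B₁·2CpertRec∕(1−ρ′)) + √(2B₂·Λ₂·CpertRec) + √(2B₃·Λ₃·CpertRec) + Λ₄C + Λ₅C`, `θ := √ρ′`,
`ρ′ = max θ_NE3 L⁻¹` — by ONE application of §1's `weightedEntrywiseRate_balaban_rate_on` at `Bg' := R.carriers.BgB`.  No chart, no `comap`, no identification
line beyond `hSA`∕`hSB`.  (K-test of leaf-04 gen 8, probe §P3, as a theorem.) -/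
theorem weightedEntrywiseRate_record_balaban_rate_on (S : Slots R (Species T κ ι Ω 𝒴) IOp Hist)
    {rawA₀ : (ℕ → ℝ) → R.carriers.BgA → ℕ → RawSpecies T κ ι Ω 𝒴} {rawB₀ : (ℕ → ℝ) → R.carriers.BgB → ℕ → RawSpecies T κ ι Ω 𝒴}
    (hSA : ∀ g V k, S.rawA g V k = (rawA₀ g V k).kernel) (hSB : ∀ g U k, S.rawB g U k = (rawB₀ g U k).kernel)
    {dom : Set BgD} (hL : 2 ≤ L) (hd : 1 ≤ d)
    {RgV : BgD → ((k : ℕ) → Fin d → (Tor (fine (lev L k) M) → Matrix o o ℂ))}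
    (hreg : ∀ V ∈ dom, RegularTransporters L M (liftR L M (RgV V)) α β) (hα : 0 ≤ α) (hβ : 0 ≤ β) (hC : 0 ≤ C) {θ : ℝ}
    (hθ0 : 0 ≤ θ) (hθ1 : θ < 1) (hloc : ∀ V ∈ dom, LocalRate (bgReadings L M (regClass L M (liftR L M (RgV V)))) C θ)
    {Rp : Readings ιp Xp} (hRp : LocalRate Rp C θ)
    (ha' : 0 < a') (hαη : α ≤ η) (hβη : β ≤ η) (hη : η ≤ etaStar o d a a')
    {tow : ℕ → (ℕ → ℝ) → R.carriers.BgB → ↥dom} {W : Set (ℕ → ℝ)}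
    {σ : T → κ → idx L M 0 × o} {dist₁ : idx L M 0 × o → idx L M 0 × o → ℝ} {B₁ δ₁ : ℝ}
    (hdec : ∀ V ∈ dom, ∀ k, EntryDecay dist₁
      (pertCovC L M a ha (balabanPert L M a (liftR L M (RgV V)) (gaugeSlot L M (RgV V) (QuT L M o (siteT L M (RgV V))) (Q1 L M o) a'))
        1 k) B₁ δ₁)
    {Scov : Set ℕ} (hcovA : ReadsTowerCovAOn Scov
      (fun V : ↥dom => pertCovC L M a ha
        (balabanPert L M a (liftR L M (RgV V)) (gaugeSlot L M (RgV V) (QuT L M o (siteT L M (RgV V))) (Q1 L M o) a')) 1)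
      σ tow (fun g U k => rawA₀ g (R.carriers.transport U) k) W)
    (hcovB : ReadsTowerCovBOn Scov
      (fun V : ↥dom => pertCovC L M a ha
        (balabanPert L M a (liftR L M (RgV V)) (gaugeSlot L M (RgV V) (QuT L M o (siteT L M (RgV V))) (Q1 L M o) a')) 1)
      σ tow rawB₀ W)
    (hdom₁ : CovWeightDominatesDist S.F dist₁ σ (δ₁ / 2))
    (hoff : ∀ k ∉ Scov, ∀ g ∈ W, ∀ (U : R.carriers.BgB) (t : T) (p q : κ),
      (rawA₀ g (R.carriers.transport U) k).cov t p q = (rawB₀ g U k).cov t p q)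
    {S₂ : Set (Matrix (idx L M 0 × o) (idx L M 0 × o) ℂ)} {Φ : T → Matrix (idx L M 0 × o) (idx L M 0 × o) ℂ → Matrix m m ℂ}
    {Λ₂ : ℝ} (hΦ : ∀ t, OpLipschitzOn S₂ (Φ t) Λ₂) (hΛ₂ : 0 ≤ Λ₂)
    (hS₂ : ∀ V ∈ dom, ∀ k, pertCovC L M a ha
      (balabanPert L M a (liftR L M (RgV V)) (gaugeSlot L M (RgV V) (QuT L M o (siteT L M (RgV V))) (Q1 L M o) a')) 1 k ∈ S₂)
    {dist₂ : m → m → ℝ} {B₂ δ₂ : ℝ}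
    (hdecΦ : ∀ V ∈ dom, ∀ t k, EntryDecay dist₂ (Φ t (pertCovC L M a ha
      (balabanPert L M a (liftR L M (RgV V)) (gaugeSlot L M (RgV V) (QuT L M o (siteT L M (RgV V))) (Q1 L M o) a')) 1 k)) B₂ δ₂)
    {σX : T → ι → m}
    (hΔA : ReadsTowerDeltaA (fun (V : ↥dom) t k => Φ t (pertCovC L M a ha
      (balabanPert L M a (liftR L M (RgV V)) (gaugeSlot L M (RgV V) (QuT L M o (siteT L M (RgV V))) (Q1 L M o) a')) 1 k))
      σX tow (fun g U k => rawA₀ g (R.carriers.transport U) k) W)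
    (hΔB : ReadsTowerDeltaB (fun (V : ↥dom) t k => Φ t (pertCovC L M a ha
      (balabanPert L M a (liftR L M (RgV V)) (gaugeSlot L M (RgV V) (QuT L M o (siteT L M (RgV V))) (Q1 L M o) a')) 1 k))
      σX tow rawB₀ W)
    (hdom₂ : DeltaWeightDominatesDist S.F dist₂ σX (δ₂ / 2))
    {S₃ : Set (Matrix (idx L M 0 × o) (idx L M 0 × o) ℂ)} {Ψ : T → Matrix (idx L M 0 × o) (idx L M 0 × o) ℂ → Matrix m m ℂ}
    {Λ₃ : ℝ} (hΨ : ∀ t, OpLipschitzOn S₃ (Ψ t) Λ₃) (hΛ₃ : 0 ≤ Λ₃)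
    (hS₃ : ∀ V ∈ dom, ∀ k, pertCovC L M a ha
      (balabanPert L M a (liftR L M (RgV V)) (gaugeSlot L M (RgV V) (QuT L M o (siteT L M (RgV V))) (Q1 L M o) a')) 1 k ∈ S₃)
    {dist₃ : m → m → ℝ} {B₃ δ₃ : ℝ}
    (hdecΨ : ∀ V ∈ dom, ∀ t k, EntryDecay dist₃ (Ψ t (pertCovC L M a ha
      (balabanPert L M a (liftR L M (RgV V)) (gaugeSlot L M (RgV V) (QuT L M o (siteT L M (RgV V))) (Q1 L M o) a')) 1 k)) B₃ δ₃)
    {σB : T → κ → m}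
    (hΓA : ReadsTowerGammaA (fun (V : ↥dom) t k => Ψ t (pertCovC L M a ha
      (balabanPert L M a (liftR L M (RgV V)) (gaugeSlot L M (RgV V) (QuT L M o (siteT L M (RgV V))) (Q1 L M o) a')) 1 k))
      σB σX tow (fun g U k => rawA₀ g (R.carriers.transport U) k) W)
    (hΓB : ReadsTowerGammaB (fun (V : ↥dom) t k => Ψ t (pertCovC L M a ha
      (balabanPert L M a (liftR L M (RgV V)) (gaugeSlot L M (RgV V) (QuT L M o (siteT L M (RgV V))) (Q1 L M o) a')) 1 k))
      σB σX tow rawB₀ W)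
    (hdom₃ : GammaWeightDominatesDist S.F dist₃ σB σX (δ₃ / 2))
    {Λ₄ Λ₅ : ℝ} (hΛ₄ : 0 ≤ Λ₄) (hΛ₅ : 0 ≤ Λ₅)
    (hQ : PotQLipschitzReading Rp S.F
      (fun g U k => rawA₀ g (R.carriers.transport U) k) rawB₀ W Λ₄)
    (hR : PotRLipschitzReading Rp S.F
      (fun g U k => rawA₀ g (R.carriers.transport U) k) rawB₀ W Λ₅) :
    -- ↓↓ the `hwer` binder of `B13StepEndInsOp.ne5_of_record_insOp S E₀ cB`, verbatim shape ↓↓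
    WeightedEntrywiseRate S.F (assembly S).rawAt S.rawB W
      (Real.sqrt (2 * B₁ * (2 * CpertRec o d L a α β C a' / (1 - max θ ((L : ℝ)⁻¹)))) +
          Real.sqrt (2 * B₂ * (Λ₂ * CpertRec o d L a α β C a')) +
          Real.sqrt (2 * B₃ * (Λ₃ * CpertRec o d L a α β C a')) +
          Λ₄ * C + Λ₅ * C)
      (fun k => Real.sqrt (max θ ((L : ℝ)⁻¹)) ^ k) := by
  intro k g hg U e
  show ‖S.rawA g (R.carriers.transport U) k e - S.rawB g U k e‖ ≤ _
  rw [hSA, hSB]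
  exact weightedEntrywiseRate_balaban_rate_on L M a ha hL hd hreg hα hβ hC hθ0 hθ1 hloc hRp ha' hαη hβη hη hdec hcovA hcovB hdom₁ hoff hΦ hΛ₂ hS₂
    hdecΦ hΔA hΔB hdom₂ hΨ hΛ₃ hS₃ hdecΨ hΓA hΓB hdom₃ hΛ₄ hΛ₅ hQ hR k g hg U e

/-- [folklore] Sanity (all `rfl`): run A's assembled supplier IS run A's slot read at the transported background, and the format of the assembly is the
slots' format — so §2's conclusion is the `hwer` binder type of `B13StepEndInsOp.ne5_of_record_insOp S E₀ cB` on the nose. -/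
example (S : Slots R (Species T κ ι Ω 𝒴) IOp Hist) :
    ((assembly S).rawAt = fun g U k => S.rawA g (R.carriers.transport U) k) ∧ (assembly S).rawB = S.rawB ∧ (assembly S).F = S.F :=
  ⟨rfl, rfl, rfl⟩

end Record


end Summit.QuantumFields.BalabanUV.T4Continuum.B13ReadingsRecordRate

end
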